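import Mathlib.Data.ZMod.Basic
import Mathlib.Data.Finset.Card
import Mathlib.Tactic.Group
import Mathlib.Tactic.LinearCombination

/-!
# ω-census, family (b3): the class `𝒞₂` — coordinates `κ = (κ₁, κ₂) : G → F₃²`, the commutator subgroup `K ≅ C₃²`, cell words

HONEST FRAMING (pub-omega census; verbatim): lottery ticket; floor = certified bounds/negative ranges.
Census BOOKKEEPING (prereg P-031.3 of the cell, session B, file B1): the algebraic half of a certified NEGATIVE RANGE for single
TPP triples with two `3`-sets in the groups of the class `𝒞₂ = {C₃² ⋊_ε C : C abelian acting through ±1}` (centre quotient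
`Dih(C₃²)`); nothing here is progress on `ω`.  This is `CentreIndexSixCoord` with a two-component coordinate.

THE PACKAGE `Coord₂ c₁ c₂ κ₁ κ₂ ε`: `c₁³ = c₂³ = 1`, `c₁ c₂ = c₂ c₁`, `κ_i(c_j) = δ_ij`, a sign character `ε : G → {±1} ⊆ ZMod 3`,
crossed coordinates `κ_i(gh) = κ_i g + ε(g) κ_i h`, and all commutators in `K = {c₁^a c₂^b}`.  CONTENTS: the algebra of `κ_i, ε`,
closure of `K` (products, inverses, conjugation), `ε = 1` on `K`, `(κ₁, κ₂)` injective on `K`; for cells `P = (x, y, w)`: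
`key P · (key P')⁻¹ = E(P,P') · k` (`k ∈ K`), two cells of one coset fibre have `E(P,P') ∈ K`, and the FIBRE WORD FORMULA per
component (`kap₁_E_fibre`, `kap₂_E_fibre`), exactly as in the `d = 1` file.  Elementary mathematics of the cell (pub-omega stpp-1
gen 14, scaffold for the successor's session B); it lives under `Summits/`.
-/

open Finset

namespace Summit.MatrixMultiplication.OmegaCensus.DihC3Sq

variable {G : Type*} [Group G]

/-- Membership in `K = ⟨c₁, c₂⟩ = {c₁^a c₂^b : a, b < 3}` (listed). [folklore] -/
def InK2 (c₁ c₂ u : G) : Prop :=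
  u = 1 ∨ u = c₁ ∨ u = c₁ * c₁ ∨ u = c₂ ∨ u = c₁ * c₂ ∨ u = c₁ * c₁ * c₂ ∨ u = c₂ * c₂ ∨ u = c₁ * (c₂ * c₂) ∨
    u = c₁ * c₁ * (c₂ * c₂)

/-- The hypothesis package of the class `𝒞₂`. [folklore] -/
def Coord2 (c₁ c₂ : G) (κ₁ κ₂ ε : G → ZMod 3) : Prop :=
  c₁ * c₁ * c₁ = 1 ∧ c₂ * c₂ * c₂ = 1 ∧ c₁ * c₂ = c₂ * c₁ ∧ κ₁ c₁ = 1 ∧ κ₂ c₁ = 0 ∧ κ₁ c₂ = 0 ∧ κ₂ c₂ = 1 ∧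
    (∀ g, ε g = 1 ∨ ε g = -1) ∧ (∀ g k, κ₁ (g * k) = κ₁ g + ε g * κ₁ k) ∧ (∀ g k, κ₂ (g * k) = κ₂ g + ε g * κ₂ k) ∧
      (∀ g k, ε (g * k) = ε g * ε k) ∧ ∀ a b : G, ∃ u, InK2 c₁ c₂ u ∧ a * b = b * a * u

/-- The TPP word of two cells `P = (x, y, w)`, `P' = (x', y', w')`: `x x'⁻¹ (y y'⁻¹) (w w'⁻¹)`. [folklore] -/
def E2 (P P' : G × G × G) : G := P.1 * P'.1⁻¹ * (P.2.1 * P'.2.1⁻¹) * (P.2.2 * P'.2.2⁻¹)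

/-- The product `x y w` of a cell. [folklore] -/
def key2 (P : G × G × G) : G := P.1 * P.2.1 * P.2.2

/-- The label (`< 18`) of an element: `(κ₁, κ₂)` and the sign, i.e. its image in `G/Z(G) ≅ Dih(C₃²)`, encoded as in
`DihC3SqModel` (`κ₁ + 3 κ₂ + 9·[reflection]`). [folklore] -/
def lab2 {α : Type*} (κ₁ κ₂ ε : α → ZMod 3) (y : α) : ℕ := (κ₁ y).val + 3 * (κ₂ y).val + if ε y = 1 then 0 else 9

/-- Labels are `< 18`. [folklore] -/
theorem lab2_lt {α : Type*} (κ₁ κ₂ ε : α → ZMod 3) (y : α) : lab2 κ₁ κ₂ ε y < 18 := by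
  unfold lab2; have := (κ₁ y).val_lt; have := (κ₂ y).val_lt; split_ifs <;> omega

namespace Coord2

variable {c₁ c₂ : G} {κ₁ κ₂ ε : G → ZMod 3} (h : Coord2 c₁ c₂ κ₁ κ₂ ε)
include h

/-! ### Algebra in coordinates -/

/-- `c₁³ = 1`. [folklore] -/ theorem c1_cube : c₁ * c₁ * c₁ = 1 := h.1
/-- `c₂³ = 1`. [folklore] -/ theorem c2_cube : c₂ * c₂ * c₂ = 1 := h.2.1
/-- `c₁ c₂ = c₂ c₁`. [folklore] -/ theorem c_comm : c₁ * c₂ = c₂ * c₁ := h.2.2.1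
/-- `κ₁ c₁ = 1`. [folklore] -/ theorem kap1_c1 : κ₁ c₁ = 1 := h.2.2.2.1
/-- `κ₂ c₁ = 0`. [folklore] -/ theorem kap2_c1 : κ₂ c₁ = 0 := h.2.2.2.2.1
/-- `κ₁ c₂ = 0`. [folklore] -/ theorem kap1_c2 : κ₁ c₂ = 0 := h.2.2.2.2.2.1
/-- `κ₂ c₂ = 1`. [folklore] -/ theorem kap2_c2 : κ₂ c₂ = 1 := h.2.2.2.2.2.2.1
/-- `ε = ±1`. [folklore] -/ theorem sign (g : G) : ε g = 1 ∨ ε g = -1 := h.2.2.2.2.2.2.2.1 g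
/-- `κ₁(gk) = κ₁ g + ε g κ₁ k`. [folklore] -/ theorem kap1_mul (g k : G) : κ₁ (g * k) = κ₁ g + ε g * κ₁ k := h.2.2.2.2.2.2.2.2.1 g k
/-- `κ₂(gk) = κ₂ g + ε g κ₂ k`. [folklore] -/ theorem kap2_mul (g k : G) : κ₂ (g * k) = κ₂ g + ε g * κ₂ k := h.2.2.2.2.2.2.2.2.2.1 g k
/-- `ε(gk) = ε g ε k`. [folklore] -/ theorem eps_mul (g k : G) : ε (g * k) = ε g * ε k := h.2.2.2.2.2.2.2.2.2.2.1 g k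
/-- Commutators lie in `K`. [folklore] -/
theorem comm (a b : G) : ∃ u, InK2 c₁ c₂ u ∧ a * b = b * a * u := h.2.2.2.2.2.2.2.2.2.2.2 a b

/-- `ε² = 1`. [folklore] -/
theorem eps_sq (g : G) : ε g ^ 2 = 1 := by rcases h.sign g with e | e <;> rw [e] <;> decide

/-- `ε 1 = 1` (stated as `1 = ε 1`). [folklore] -/
theorem eps_one₂ : (1 : ZMod 3) = ε 1 := by
  have e := h.eps_mul 1 1
  rw [mul_one] at e
  rcases h.sign 1 with e1 | e1
  · exact e1.symm
  · rw [e1] at e; exact absurd e (by decide)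

/-- `κ₁ 1 = 0`. [folklore] -/
theorem kap1_one : κ₁ 1 = 0 := by
  have e := h.kap1_mul 1 1; rw [mul_one, ← h.eps_one₂, one_mul] at e; linear_combination (-1 : ZMod 3) * e

/-- `κ₂ 1 = 0`. [folklore] -/
theorem kap2_one : κ₂ 1 = 0 := by
  have e := h.kap2_mul 1 1; rw [mul_one, ← h.eps_one₂, one_mul] at e; linear_combination (-1 : ZMod 3) * e

/-- `κ₁(g⁻¹) = −ε g κ₁ g`. [folklore] -/
theorem kap1_inv (g : G) : κ₁ g⁻¹ = -(ε g * κ₁ g) := by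
  have e := h.kap1_mul g g⁻¹; rw [mul_inv_cancel, h.kap1_one] at e
  linear_combination (-(ε g)) * e + (-(κ₁ g⁻¹)) * h.eps_sq g

/-- `κ₂(g⁻¹) = −ε g κ₂ g`. [folklore] -/
theorem kap2_inv (g : G) : κ₂ g⁻¹ = -(ε g * κ₂ g) := by
  have e := h.kap2_mul g g⁻¹; rw [mul_inv_cancel, h.kap2_one] at e
  linear_combination (-(ε g)) * e + (-(κ₂ g⁻¹)) * h.eps_sq g

/-- `ε(g⁻¹) = ε g` (stated as `ε g = ε g⁻¹`). [folklore] -/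
theorem eps_inv₂ (g : G) : ε g = ε g⁻¹ := by
  have e := h.eps_mul g g⁻¹; rw [mul_inv_cancel, ← h.eps_one₂] at e
  linear_combination e * ε g + (ε g⁻¹) * h.eps_sq g

/-- `ε c₁ = 1`. [folklore] -/
theorem eps_c1 : ε c₁ = 1 := by
  rcases h.sign c₁ with e | e
  · exact e
  · exfalso
    have e3 := h.kap1_mul (c₁ * c₁) c₁
    rw [h.c1_cube, h.kap1_one, h.eps_mul, h.kap1_mul, h.kap1_c1, e] at e3
    exact absurd e3 (by decide)

/-- `ε c₂ = 1`. [folklore] -/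
theorem eps_c2 : ε c₂ = 1 := by
  rcases h.sign c₂ with e | e
  · exact e
  · exfalso
    have e3 := h.kap2_mul (c₂ * c₂) c₂
    rw [h.c2_cube, h.kap2_one, h.eps_mul, h.kap2_mul, h.kap2_c2, e] at e3
    exact absurd e3 (by decide)

/-- `ε = 1` on `K`. [folklore] -/
theorem inK_eps {u : G} (hu : InK2 c₁ c₂ u) : ε u = 1 := by
  rcases hu with rfl | rfl | rfl | rfl | rfl | rfl | rfl | rfl | rfl <;>
    simp only [← h.eps_one₂, h.eps_c1, h.eps_c2, h.eps_mul, mul_one]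

/-- The coordinates of the nine elements of `K`. [folklore] -/
theorem inK_kap {u : G} (hu : InK2 c₁ c₂ u) :
    (κ₁ u = 0 ∧ κ₂ u = 0 ∧ u = 1) ∨ (κ₁ u = 1 ∧ κ₂ u = 0 ∧ u = c₁) ∨ (κ₁ u = -1 ∧ κ₂ u = 0 ∧ u = c₁ * c₁) ∨
      (κ₁ u = 0 ∧ κ₂ u = 1 ∧ u = c₂) ∨ (κ₁ u = 1 ∧ κ₂ u = 1 ∧ u = c₁ * c₂) ∨ (κ₁ u = -1 ∧ κ₂ u = 1 ∧ u = c₁ * c₁ * c₂) ∨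
        (κ₁ u = 0 ∧ κ₂ u = -1 ∧ u = c₂ * c₂) ∨ (κ₁ u = 1 ∧ κ₂ u = -1 ∧ u = c₁ * (c₂ * c₂)) ∨
          (κ₁ u = -1 ∧ κ₂ u = -1 ∧ u = c₁ * c₁ * (c₂ * c₂)) := by
  rcases hu with rfl | rfl | rfl | rfl | rfl | rfl | rfl | rfl | rfl
  · exact Or.inl ⟨h.kap1_one, h.kap2_one, rfl⟩
  · exact Or.inr (Or.inl ⟨h.kap1_c1, h.kap2_c1, rfl⟩)
  · refine Or.inr (Or.inr (Or.inl ⟨?_, ?_, rfl⟩)) <;>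
      simp only [h.kap1_mul, h.kap2_mul, h.kap1_c1, h.kap2_c1, h.eps_c1] <;> decide
  · exact Or.inr (Or.inr (Or.inr (Or.inl ⟨h.kap1_c2, h.kap2_c2, rfl⟩)))
  · refine Or.inr (Or.inr (Or.inr (Or.inr (Or.inl ⟨?_, ?_, rfl⟩)))) <;>
      simp only [h.kap1_mul, h.kap2_mul, h.kap1_c1, h.kap2_c1, h.kap1_c2, h.kap2_c2, h.eps_c1] <;> decide
  · refine Or.inr (Or.inr (Or.inr (Or.inr (Or.inr (Or.inl ⟨?_, ?_, rfl⟩))))) <;>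
      simp only [h.kap1_mul, h.kap2_mul, h.kap1_c1, h.kap2_c1, h.kap1_c2, h.kap2_c2, h.eps_c1, h.eps_mul] <;> decide
  · refine Or.inr (Or.inr (Or.inr (Or.inr (Or.inr (Or.inr (Or.inl ⟨?_, ?_, rfl⟩)))))) <;>
      simp only [h.kap1_mul, h.kap2_mul, h.kap1_c2, h.kap2_c2, h.eps_c2] <;> decide
  · refine Or.inr (Or.inr (Or.inr (Or.inr (Or.inr (Or.inr (Or.inr (Or.inl ⟨?_, ?_, rfl⟩))))))) <;>
      simp only [h.kap1_mul, h.kap2_mul, h.kap1_c1, h.kap2_c1, h.kap1_c2, h.kap2_c2, h.eps_c1, h.eps_c2] <;> decide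
  · refine Or.inr (Or.inr (Or.inr (Or.inr (Or.inr (Or.inr (Or.inr (Or.inr ⟨?_, ?_, rfl⟩))))))) <;>
      simp only [h.kap1_mul, h.kap2_mul, h.kap1_c1, h.kap2_c1, h.kap1_c2, h.kap2_c2, h.eps_c1, h.eps_c2, h.eps_mul] <;> decide

/-- On `K`, `(κ₁, κ₂) = 0` only at `1`. [folklore] -/
theorem inK_eq_one {u : G} (hu : InK2 c₁ c₂ u) (h1 : κ₁ u = 0) (h2 : κ₂ u = 0) : u = 1 := by
  rcases h.inK_kap hu with ⟨-, -, e⟩ | ⟨a, b, -⟩ | ⟨a, b, -⟩ | ⟨a, b, -⟩ | ⟨a, b, -⟩ | ⟨a, b, -⟩ | ⟨a, b, -⟩ | ⟨a, b, -⟩ |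
      ⟨a, b, -⟩
  · exact e
  all_goals (first | (rw [h1] at a; exact absurd a (by decide)) | (rw [h2] at b; exact absurd b (by decide)))

/-- `(κ₁, κ₂)` is injective on `K`. [folklore] -/
theorem inK_eq_of_kap {u v : G} (hu : InK2 c₁ c₂ u) (hv : InK2 c₁ c₂ v) (e1 : κ₁ u = κ₁ v) (e2 : κ₂ u = κ₂ v) : u = v := by
  rcases h.inK_kap hu with ⟨a, b, rfl⟩ | ⟨a, b, rfl⟩ | ⟨a, b, rfl⟩ | ⟨a, b, rfl⟩ | ⟨a, b, rfl⟩ | ⟨a, b, rfl⟩ | ⟨a, b, rfl⟩ |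
      ⟨a, b, rfl⟩ | ⟨a, b, rfl⟩ <;>
    rcases h.inK_kap hv with ⟨a', b', rfl⟩ | ⟨a', b', rfl⟩ | ⟨a', b', rfl⟩ | ⟨a', b', rfl⟩ | ⟨a', b', rfl⟩ | ⟨a', b', rfl⟩ |
        ⟨a', b', rfl⟩ | ⟨a', b', rfl⟩ | ⟨a', b', rfl⟩ <;>
    first | rfl | (rw [a, a'] at e1; exact absurd e1 (by decide)) | (rw [b, b'] at e2; exact absurd e2 (by decide))

/-! ### Closure of `K` (through exponents `c₁ ^ a * c₂ ^ b`) -/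

/-- `c₁ ^ 3 = 1`. [folklore] -/
theorem c1_pow_three : c₁ ^ 3 = 1 := by rw [pow_succ, pow_two]; exact h.c1_cube
/-- `c₂ ^ 3 = 1`. [folklore] -/
theorem c2_pow_three : c₂ ^ 3 = 1 := by rw [pow_succ, pow_two]; exact h.c2_cube

/-- `c₁` and `c₂` commute. [folklore] -/
theorem commute12 : Commute c₁ c₂ := h.c_comm

/-- Powers of `c₁` reduce `mod 3`. [folklore] -/
theorem c1_pow_mod (n : ℕ) : c₁ ^ n = c₁ ^ (n % 3) := by
  conv_lhs => rw [← Nat.div_add_mod n 3, pow_add, pow_mul, h.c1_pow_three, one_pow, one_mul]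
/-- Powers of `c₂` reduce `mod 3`. [folklore] -/
theorem c2_pow_mod (n : ℕ) : c₂ ^ n = c₂ ^ (n % 3) := by
  conv_lhs => rw [← Nat.div_add_mod n 3, pow_add, pow_mul, h.c2_pow_three, one_pow, one_mul]

/-- `K` through exponents. [folklore] -/
theorem inK2_iff (u : G) : InK2 c₁ c₂ u ↔ ∃ a < 3, ∃ b < 3, u = c₁ ^ a * c₂ ^ b := by
  constructor
  · rintro (rfl | rfl | rfl | rfl | rfl | rfl | rfl | rfl | rfl)
    · exact ⟨0, by omega, 0, by omega, by simp⟩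
    · exact ⟨1, by omega, 0, by omega, by simp⟩
    · exact ⟨2, by omega, 0, by omega, by simp [pow_two]⟩
    · exact ⟨0, by omega, 1, by omega, by simp⟩
    · exact ⟨1, by omega, 1, by omega, by simp⟩
    · exact ⟨2, by omega, 1, by omega, by simp [pow_two]⟩
    · exact ⟨0, by omega, 2, by omega, by simp [pow_two]⟩
    · exact ⟨1, by omega, 2, by omega, by simp [pow_two]⟩
    · exact ⟨2, by omega, 2, by omega, by simp [pow_two]⟩
  · rintro ⟨a, ha, b, hb, rfl⟩
    have ha' : a = 0 ∨ a = 1 ∨ a = 2 := by omega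
    have hb' : b = 0 ∨ b = 1 ∨ b = 2 := by omega
    rcases ha' with rfl | rfl | rfl <;> rcases hb' with rfl | rfl | rfl <;> simp [InK2, pow_two]

/-- `K` is closed under products. [folklore] -/
theorem inK_mul {u v : G} (hu : InK2 c₁ c₂ u) (hv : InK2 c₁ c₂ v) : InK2 c₁ c₂ (u * v) := by
  rw [h.inK2_iff] at hu hv ⊢
  obtain ⟨a, -, b, -, rfl⟩ := hu
  obtain ⟨a', -, b', -, rfl⟩ := hv
  refine ⟨(a + a') % 3, Nat.mod_lt _ (by norm_num), (b + b') % 3, Nat.mod_lt _ (by norm_num), ?_⟩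
  rw [← h.c1_pow_mod, ← h.c2_pow_mod, pow_add, pow_add, mul_assoc, mul_assoc, ← mul_assoc (c₂ ^ b),
    (h.commute12.pow_pow a' b).symm.eq, mul_assoc]

/-- `K` is closed under inverses. [folklore] -/
theorem inK_inv {u : G} (hu : InK2 c₁ c₂ u) : InK2 c₁ c₂ u⁻¹ := by
  rw [h.inK2_iff] at hu ⊢
  obtain ⟨a, ha, b, hb, rfl⟩ := hu
  refine ⟨(3 - a) % 3, Nat.mod_lt _ (by norm_num), (3 - b) % 3, Nat.mod_lt _ (by norm_num), ?_⟩
  rw [← h.c1_pow_mod, ← h.c2_pow_mod]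
  apply inv_eq_of_mul_eq_one_right
  rw [mul_assoc, ← mul_assoc (c₂ ^ b), (h.commute12.pow_pow (3 - a) b).symm.eq, mul_assoc, ← pow_add,
    ← mul_assoc, ← pow_add, show a + (3 - a) = 3 by omega, show b + (3 - b) = 3 by omega, h.c1_pow_three, h.c2_pow_three,
    one_mul]

/-- `K` moves past any element: `u a = a v` with `v ∈ K`. [folklore] -/
theorem inK_move {u : G} (hu : InK2 c₁ c₂ u) (a : G) : ∃ v, InK2 c₁ c₂ v ∧ u * a = a * v := by
  obtain ⟨w, hw, e⟩ := h.comm u a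
  exact ⟨u * w, h.inK_mul hu hw, by rw [e, mul_assoc]⟩

/-- `K` is closed under conjugation. [folklore] -/
theorem inK_conj {u : G} (hu : InK2 c₁ c₂ u) (g : G) : InK2 c₁ c₂ (g * u * g⁻¹) := by
  obtain ⟨w, hw, e⟩ := h.comm (g * u) g⁻¹
  rw [e, inv_mul_cancel_left]
  exact h.inK_mul hu hw

/-! ### Cell words -/

/-- `key P · (key P')⁻¹ = E(P, P') · u` with `u ∈ K` (two commutators). [folklore] -/
theorem key_mul_inv (P P' : G × G × G) : ∃ u, InK2 c₁ c₂ u ∧ key2 P * (key2 P')⁻¹ = E2 P P' * u := by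
  obtain ⟨x, y, w⟩ := P
  obtain ⟨x', y', w'⟩ := P'
  simp only [key2, E2]
  obtain ⟨v₁, hv₁, e₁⟩ := h.comm (w * w'⁻¹) y'⁻¹
  obtain ⟨v₂, hv₂, e₂⟩ := h.inK_move hv₁ x'⁻¹
  obtain ⟨v₃, hv₃, e₃⟩ := h.comm (y * y'⁻¹ * (w * w'⁻¹)) x'⁻¹
  refine ⟨v₃ * v₂, h.inK_mul hv₃ hv₂, ?_⟩
  calc x * y * w * (x' * y' * w')⁻¹ = x * y * (w * w'⁻¹ * y'⁻¹) * x'⁻¹ := by group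
    _ = x * y * (y'⁻¹ * (w * w'⁻¹) * v₁) * x'⁻¹ := by rw [e₁]
    _ = x * (y * y'⁻¹ * (w * w'⁻¹)) * (v₁ * x'⁻¹) := by group
    _ = x * (y * y'⁻¹ * (w * w'⁻¹)) * (x'⁻¹ * v₂) := by rw [e₂]
    _ = x * (y * y'⁻¹ * (w * w'⁻¹) * x'⁻¹) * v₂ := by group
    _ = x * (x'⁻¹ * (y * y'⁻¹ * (w * w'⁻¹)) * v₃) * v₂ := by rw [e₃]
    _ = x * x'⁻¹ * (y * y'⁻¹) * (w * w'⁻¹) * (v₃ * v₂) := by group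

/-- Two cells of one fibre have their word in `K`. [folklore] -/
theorem inK_E {g : G} {P P' : G × G × G} (hP : InK2 c₁ c₂ (g⁻¹ * key2 P)) (hP' : InK2 c₁ c₂ (g⁻¹ * key2 P')) :
    InK2 c₁ c₂ (E2 P P') := by
  obtain ⟨u₀, hu₀, e₀⟩ := h.key_mul_inv P P'
  have hk : InK2 c₁ c₂ (key2 P * (key2 P')⁻¹) := by
    have : key2 P * (key2 P')⁻¹ = g * (g⁻¹ * key2 P * (g⁻¹ * key2 P')⁻¹) * g⁻¹ := by group
    rw [this]
    exact h.inK_conj (h.inK_mul hP (h.inK_inv hP')) g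
  have : E2 P P' = key2 P * (key2 P')⁻¹ * u₀⁻¹ := by rw [e₀]; group
  rw [this]
  exact h.inK_mul hk (h.inK_inv hu₀)

/-! ### The word formula -/


/-- The `c₁`-exponent of a word, expanded. [folklore] -/
theorem kap1_E (x y w x' y' w' : G) : κ₁ (E2 (x, y, w) (x', y', w')) =
    κ₁ x - ε x * ε x' * κ₁ x' + ε x * ε x' * (κ₁ y - ε y * ε y' * κ₁ y' + ε y * ε y' * (κ₁ w - ε w * ε w' * κ₁ w')) := by
  simp only [E2, h.kap1_mul, h.eps_mul, h.kap1_inv, ← h.eps_inv₂]; ring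

/-- The `c₂`-exponent of a word, expanded. [folklore] -/
theorem kap2_E (x y w x' y' w' : G) : κ₂ (E2 (x, y, w) (x', y', w')) =
    κ₂ x - ε x * ε x' * κ₂ x' + ε x * ε x' * (κ₂ y - ε y * ε y' * κ₂ y' + ε y * ε y' * (κ₂ w - ε w * ε w' * κ₂ w')) := by
  simp only [E2, h.kap2_mul, h.eps_mul, h.kap2_inv, ← h.eps_inv₂]; ring

/-- In the fibre of `g`, the sign of the first coordinate is `ε g ε y ε w`. [folklore] -/
theorem eps_of_fibre {g x y w : G} (hu : InK2 c₁ c₂ (g⁻¹ * (x * y * w))) : ε x = ε g * ε y * ε w := by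
  have e := h.inK_eps hu
  rw [h.eps_mul, h.eps_mul, h.eps_mul, ← h.eps_inv₂] at e
  linear_combination (-(ε x)) * e + (ε g * ε y * ε w) * h.eps_sq x

/-- **The fibre word formula, first component**: with `λ₁ = ε_y ε_w κ₁ x`,
`κ₁(E(P,P')) = ε_y ε_w (λ₁ − λ₁' + ε_{y'} ε_{w'} B₁)`. [folklore] -/
theorem kap1_E_fibre {g x y w x' y' w' : G} (hu : InK2 c₁ c₂ (g⁻¹ * (x * y * w)))
    (hu' : InK2 c₁ c₂ (g⁻¹ * (x' * y' * w'))) :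
    κ₁ (E2 (x, y, w) (x', y', w')) = ε y * ε w * (ε y * ε w * κ₁ x - ε y' * ε w' * κ₁ x' +
      ε y' * ε w' * (κ₁ y - ε y * ε y' * κ₁ y' + ε y * ε y' * (κ₁ w - ε w * ε w' * κ₁ w'))) := by
  rw [h.kap1_E, h.eps_of_fibre hu, h.eps_of_fibre hu']
  linear_combination (-(κ₁ x * ε w * ε w)) * h.eps_sq y + (-(κ₁ x)) * h.eps_sq w +
    ((κ₁ y - ε y * ε y' * κ₁ y' + ε y * ε y' * (κ₁ w - ε w * ε w' * κ₁ w') - κ₁ x') * ε y * ε w * ε y' * ε w') * h.eps_sq g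

/-- **The fibre word formula, second component.** [folklore] -/
theorem kap2_E_fibre {g x y w x' y' w' : G} (hu : InK2 c₁ c₂ (g⁻¹ * (x * y * w)))
    (hu' : InK2 c₁ c₂ (g⁻¹ * (x' * y' * w'))) :
    κ₂ (E2 (x, y, w) (x', y', w')) = ε y * ε w * (ε y * ε w * κ₂ x - ε y' * ε w' * κ₂ x' +
      ε y' * ε w' * (κ₂ y - ε y * ε y' * κ₂ y' + ε y * ε y' * (κ₂ w - ε w * ε w' * κ₂ w'))) := by
  rw [h.kap2_E, h.eps_of_fibre hu, h.eps_of_fibre hu']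
  linear_combination (-(κ₂ x * ε w * ε w)) * h.eps_sq y + (-(κ₂ x)) * h.eps_sq w +
    ((κ₂ y - ε y * ε y' * κ₂ y' + ε y * ε y' * (κ₂ w - ε w * ε w' * κ₂ w') - κ₂ x') * ε y * ε w * ε y' * ε w') * h.eps_sq g

/-- `lab2 1 = 0`. [folklore] -/
theorem lab2_one : lab2 κ₁ κ₂ ε 1 = 0 := by
  rw [lab2, h.kap1_one, h.kap2_one, ← h.eps_one₂, ZMod.val_zero, if_pos rfl]

/-- The label read by the model: `lab2 y % 3 = (κ₁ y).val`, `lab2 y / 3 % 3 = (κ₂ y).val`, `lab2 y / 9 = [ε y = −1]`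
(so `DihC3Sq.vec (lab2 y) = (κ₁ y, κ₂ y)` and `DihC3Sq.sg (lab2 y) = ε y`). [folklore] -/
theorem lab2_parts (y : G) : lab2 κ₁ κ₂ ε y % 3 = (κ₁ y).val ∧ lab2 κ₁ κ₂ ε y / 3 % 3 = (κ₂ y).val ∧
    (lab2 κ₁ κ₂ ε y / 9 = 0 ↔ ε y = 1) := by
  have h1 := (κ₁ y).val_lt; have h2 := (κ₂ y).val_lt
  unfold lab2
  rcases h.sign y with e | e
  · rw [if_pos e]; exact ⟨by omega, by omega, by simp [e]; omega⟩
  · have hne : ε y ≠ 1 := by rw [e]; decide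
    rw [if_neg hne]; exact ⟨by omega, by omega, by constructor <;> intro hh <;> [omega; exact absurd hh hne]⟩

end Coord2

end Summit.MatrixMultiplication.OmegaCensus.DihC3Sq
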